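import Literature.NumberTheory.LFunctions.Zhang2022.Section9GatheringCore
import Literature.NumberTheory.LFunctions.Zhang2022.Section9PartialSummation
import Literature.NumberTheory.LFunctions.Zhang2022.Section8Lemma84
import Literature.NumberTheory.LFunctions.Zhang2022.AppendixALemma83Edge
import HarnessLib

/-!
# Zhang (2022) §9 p. 51: the gathering (G9) and the leaf `Step9u004r` from the relative Lemma 8.4

Y. Zhang, *Discrete mean estimates and the Landau–Siegel zero*, arXiv:2211.02515v1 (2022)
[Zhang2022LandauSiegel] — **an unrefereed manuscript under adjudication; nothing here asserts anything
about its Theorems 1–2 or about Landau–Siegel zeros.** ZHANG-L discharge lane (WP09), leaf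
`Section9Statements.Step9u004r c′` = hypothesis `h9u004r` of `Skeleton.theorem1_of_leaves_v19`
(`Z22:§9.u004`, reading (r): «S_j(𝐚₁₂,𝐚₂₂) = 𝔞∫₁^{P₃}(…)(…)dx/x + |ι₄|²𝔞(log P₂)⁻²∫_{P₃}^{P₂}𝔣_{j7}𝔤_{j7}(P₂/x)dx/x + o(α)»).

* `gathering9_of_rel` — (G9), the hypothesis of `Section9PartialSummation.step9u004r_of_gathering9`, from
  Lemma 8.2 (tree theorem `Skeleton.lemma82_holds`, `c′ ≥ 0`: `Z22:§8.u041` `step8u041_holds`, `Z22:§9.u002`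
  `Section9Discharge.step9u002_sharp`), the RELATIVE twins of `Z22:§8.u043` / `Z22:§9.u003` (errors
  `C𝓛⁻¹⁵·(∏_{q∣dr}(1−q⁻¹)⁻¹)²`) and `XiZeroMajorant.xiZeroTailMean`, via `core9Rel` + `final_small`;
* `gathering9_of_lemma84Rel`, **`step9u004r_of_lemma84Rel : 0 ≤ c′ → Lemma84Rel c′ → Step9u004r c′`**,
  `step9u004r_of_lemma83Rel` (via `Skeleton.lemma84Rel_of_lemma83Rel`), and
  **`step9u004r_of_appendixA : 0 ≤ c′ → StepA_u007_analytic c′ → StepA_u007_read c′ → Step9u004r c′`**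
  (via `Lemma83.lemma83Rel_of_parts`): in `theorem1_of_leaves_v19` the leaf `h9u004r` is a consequence of
  the leaves `hAn`, `hRead` (the two App. A §A.u007 sentences) at the fixed `c′ ≥ 0` — the same disposition
  as `h84`/`hD823` (rows G-adj1-1 / G-d55-3).

Theorem-only; 0 definitions, 0 new facts. WHAT THIS IS NOT: a proof of the App. A leaves, of Lemma 8.3,
or of `Step9u004r` outright.

## References

* Y. Zhang, arXiv:2211.02515v1 (2022), §9 p. 51, tex L2598–L2618; §8 p. 47, tex L2420–L2442, Lemmas
  8.2–8.4 pp. 45–47; App. A pp. 101–103. [cite: Zhang2022LandauSiegel, §9 p.51]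
-/

noncomputable section

open Complex Real ComplexConjugate Finset

namespace Literature.NumberTheory.LFunctions.Zhang2022.Section9Gathering

open Literature.NumberTheory.LFunctions.Zhang2022.Skeleton
open Literature.NumberTheory.LFunctions.Zhang2022.Section8FrontEnd82
open Literature.NumberTheory.LFunctions.Zhang2022.Section8FrontEnd44Reduction
open Literature.NumberTheory.LFunctions.Zhang2022.Section8FrontEnd44ReductionRel

/-! ## (G9) from the relative twins -/

/-- **The gathering (G9) of `Z22:§9.u004`** from Lemma 8.2 (`c′ ≥ 0`: `Z22:§8.u041`, `Z22:§9.u002` at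
`O(𝓛⁻¹⁵)`) and the RELATIVE twins of `Z22:§8.u043`, `Z22:§9.u003` (errors `C𝓛⁻¹⁵·(∏_{q∣dr}(1−q⁻¹)⁻¹)²`):
`S_j(𝐚₁₂,𝐚₂₂) = L′(1,χ)²[Σ_{n<P₃}Σ_{dr=n} wΠ·Φ(n) + Σ_{P₃≤n<P₂}Σ_{dr=n} wΠ·Ψ(n)] + o(α)` with the §9
profiles `Φ, Ψ` — the relative factor is absorbed by the weights (`core9Rel`), and
`K(log T)⁷𝓛⁻¹⁷ ≤ εα` for `𝓛 ≥ K¹⁰/(επ)¹⁰` (`final_small`).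
[cite: Zhang2022LandauSiegel, §9 p.51, tex L2613–L2618; §8 p.47, tex L2436] -/
theorem gathering9_of_rel {c' : ℝ} (hc' : 0 ≤ c')
    (h43 : ∃ C : ℝ, ForAllLarge fun D _ χ => AssumptionA D χ →
      ∀ j ∈ ({1, 2, 3} : Finset ℕ), ∀ d r : ℕ, 1 ≤ d → 1 ≤ r →
        ((d * r : ℕ) : ℝ) < Skeleton.P2 D / bigT D →
          ‖(∑ n ∈ Finset.Ico 1 (Nsupp D),
                χ (n : ZMod D) * conj (vk2 D (d * r * n)) * xiZero c' D j n d r / (n : ℂ)) -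
              deriv χ.LFunction 1 * PiW χ d r / (Real.log (Skeleton.P2 D) : ℂ) *
                frakgW c' D j 7 (Skeleton.P2 D / ((d * r : ℕ) : ℝ))‖ ≤
            C * (ell D ^ 15)⁻¹ * (∏ q ∈ (d * r).primeFactors, (1 - (q : ℝ)⁻¹)⁻¹) ^ 2)
    (h93 : ∃ C : ℝ, ForAllLarge fun D _ χ => AssumptionA D χ →
      ∀ j ∈ ({1, 2, 3} : Finset ℕ), ∀ d r : ℕ, 1 ≤ d → 1 ≤ r →
        ((d * r : ℕ) : ℝ) < Skeleton.P3 D / bigT D →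
          ‖(∑ n ∈ Finset.Ico 1 (Nsupp D),
                χ (n : ZMod D) * conj (vk3 D (d * r * n)) * xiZero c' D j n d r / (n : ℂ)) -
              deriv χ.LFunction 1 * PiW χ d r / (Real.log (Skeleton.P3 D) : ℂ) *
                frakgW c' D j 6 (Skeleton.P3 D / ((d * r : ℕ) : ℝ))‖ ≤
            C * (ell D ^ 15)⁻¹ * (∏ q ∈ (d * r).primeFactors, (1 - (q : ℝ)⁻¹)⁻¹) ^ 2) :
    ∀ ε : ℝ, 0 < ε → ForAllLarge fun D _ χ => AssumptionA D χ →
      ∀ j ∈ ({1, 2, 3} : Finset ℕ),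
        ‖Sj c' D j (a12 χ) (a22 χ) -
            (deriv χ.LFunction 1 ^ 2 *
                (∑ n ∈ Finset.Ico 1 ⌈Skeleton.P3 D⌉₊, ∑ p ∈ Nat.divisorsAntidiagonal n,
                  ((ArithmeticFunction.moebius p.2).natAbs : ℂ) *
                        (‖χ ((p.1 * p.2 : ℕ) : ZMod D)‖ : ℂ) /
                      (((p.1 * p.2 : ℕ) : ℂ) * (Nat.totient p.2 : ℂ)) *
                    lamZero c' D j (p.1 * p.2) * PiW χ p.1 p.2 *
                    ((conj iota3 * frakfW c' D j 6 (Skeleton.P3 D / n) / (Real.log (Skeleton.P3 D) : ℂ) +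
                        conj iota4 * frakfW c' D j 7 (Skeleton.P2 D / n) / (Real.log (Skeleton.P2 D) : ℂ)) *
                      (iota3 * frakgW c' D j 6 (Skeleton.P3 D / n) / (Real.log (Skeleton.P3 D) : ℂ) +
                        iota4 * frakgW c' D j 7 (Skeleton.P2 D / n) / (Real.log (Skeleton.P2 D) : ℂ)))) +
              deriv χ.LFunction 1 ^ 2 *
                (∑ n ∈ Finset.Ico ⌈Skeleton.P3 D⌉₊ ⌈Skeleton.P2 D⌉₊, ∑ p ∈ Nat.divisorsAntidiagonal n,
                  ((ArithmeticFunction.moebius p.2).natAbs : ℂ) *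
                        (‖χ ((p.1 * p.2 : ℕ) : ZMod D)‖ : ℂ) /
                      (((p.1 * p.2 : ℕ) : ℂ) * (Nat.totient p.2 : ℂ)) *
                    lamZero c' D j (p.1 * p.2) * PiW χ p.1 p.2 *
                    (conj iota4 * frakfW c' D j 7 (Skeleton.P2 D / n) / (Real.log (Skeleton.P2 D) : ℂ) *
                      (iota4 * frakgW c' D j 7 (Skeleton.P2 D / n) / (Real.log (Skeleton.P2 D) : ℂ)))))‖
          ≤ ε * alpha D := by
  intro ε hε
  obtain ⟨C41, D41, h41⟩ := step8u041_holds hc'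
  obtain ⟨C92, D92, h92⟩ := Section9Discharge.step9u002_sharp c' (lemma82_holds hc')
  obtain ⟨C43, D43, h43⟩ := h43
  obtain ⟨C93, D93, h93⟩ := h93
  obtain ⟨Cξ, Dξ, hξ⟩ := XiZeroMajorant.xiZeroTailMean c'
  set C₁ : ℝ := max (max |C41| |C92|) (max |C43| |C93|) with hC₁def
  have h41le : |C41| ≤ C₁ := le_trans (le_max_left _ _) (le_max_left _ _)
  have h92le : |C92| ≤ C₁ := le_trans (le_max_right _ _) (le_max_left _ _)
  have h43le : |C43| ≤ C₁ := le_trans (le_max_left _ _) (le_max_right _ _)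
  have h93le : |C93| ≤ C₁ := le_trans (le_max_right _ _) (le_max_right _ _)
  have hC₁ : 0 ≤ C₁ := (abs_nonneg C41).trans h41le
  set C₂ : ℝ := max Cξ 0 with hC₂def
  have hC₂ : 0 ≤ C₂ := le_max_right _ _
  obtain ⟨K, hK0, hcore⟩ := core9Rel c' hC₁ hC₂
  set Dfin : ℕ := ⌈Real.exp (K ^ 10 / (ε * π) ^ 10)⌉₊ with hDfin
  refine ⟨max (max (max D41 D92) (max D43 D93)) (max Dξ (max ⌈Real.exp 4⌉₊ Dfin)),
    fun D _ χ hD hq hp hA j hj => ?_⟩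
  have hD41 : D41 ≤ D :=
    le_trans (le_trans (le_max_left _ _) (le_max_left _ _)) (le_trans (le_max_left _ _) hD)
  have hD92 : D92 ≤ D :=
    le_trans (le_trans (le_max_right _ _) (le_max_left _ _)) (le_trans (le_max_left _ _) hD)
  have hD43 : D43 ≤ D :=
    le_trans (le_trans (le_max_left _ _) (le_max_right _ _)) (le_trans (le_max_left _ _) hD)
  have hD93 : D93 ≤ D :=
    le_trans (le_trans (le_max_right _ _) (le_max_right _ _)) (le_trans (le_max_left _ _) hD)
  have hDξ : Dξ ≤ D := le_trans (le_max_left _ _) (le_trans (le_max_right _ _) hD)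
  have hD4 : ⌈Real.exp 4⌉₊ ≤ D :=
    le_trans (le_trans (le_max_left _ _) (le_max_right _ _)) (le_trans (le_max_right _ _) hD)
  have hDf : Dfin ≤ D :=
    le_trans (le_trans (le_max_right _ _) (le_max_right _ _)) (le_trans (le_max_right _ _) hD)
  have hL4 : 4 ≤ ell D := four_le_ell hD4
  have hL1 : 1 ≤ ell D := by linarith
  have hL0 : 0 < ell D := by linarith
  have hinv : ∀ {C : ℝ}, |C| ≤ C₁ → C * (ell D ^ 15)⁻¹ ≤ C₁ / ell D ^ 15 := by
    intro C hC
    rw [div_eq_mul_inv]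
    exact mul_le_mul_of_nonneg_right ((le_abs_self C).trans hC) (by positivity)
  have hinvR : ∀ {C R : ℝ}, |C| ≤ C₁ → 0 ≤ R →
      C * (ell D ^ 15)⁻¹ * R ≤ C₁ / ell D ^ 15 * R := by
    intro C R hC hR
    exact mul_le_mul_of_nonneg_right (hinv hC) hR
  have key := hcore hq hp hD4 j
    (fun d r hd hr hdr => (h41 D χ hD41 hq hp hA j hj d r hd hr hdr).trans (hinv h41le))
    (fun d r hd hr hdr => (h92 D χ hD92 hq hp hA j hj d r hd hr hdr).trans (hinv h92le))
    (fun d r hd hr hdr =>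
      (h43 D χ hD43 hq hp hA j hj d r hd hr hdr).trans (hinvR h43le (sq_nonneg _)))
    (fun d r hd hr hdr =>
      (h93 D χ hD93 hq hp hA j hj d r hd hr hdr).trans (hinvR h93le (sq_nonneg _)))
    (fun d r hd hr hdr x hx1 hxT =>
      (hξ D χ hDξ hq hp j hj d r hd hr hdr x hx1 hxT).trans
        (mul_le_mul_of_nonneg_right (mul_le_mul_of_nonneg_right (le_max_left _ _) hL0.le)
          (pow_nonneg (by linarith [Real.log_nonneg hx1]) 3)))
  have hLK : K ^ 10 / (ε * π) ^ 10 ≤ ell D := by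
    have hexp : Real.exp (K ^ 10 / (ε * π) ^ 10) ≤ D :=
      le_trans (Nat.le_ceil _) (by exact_mod_cast hDf)
    exact (Real.le_log_iff_exp_le (lt_of_lt_of_le (Real.exp_pos _) hexp)).mpr hexp
  calc _ ≤ K * (ell D ^ (1.1 : ℝ)) ^ 7 / ell D ^ 17 := key
    _ ≤ ε * π / ell D ^ 9 := final_small (by positivity) hL1 hLK
    _ = ε * alpha D := by rw [Section2.alpha_eq_pi_div_ell9]; ring

/-- **(G9) from the RELATIVE Lemma 8.4** (`c′ ≥ 0`): `Skeleton.Lemma84Rel c′` supplies both relative twins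
(`Section8FrontEnd44ReductionRel.u043R_of_lemma84W`, `u9003R_of_lemma84W` with
`W = (∏_{q∣dr}(1−q⁻¹)⁻¹)²`). [cite: Zhang2022LandauSiegel, §9 p.51, tex L2613–L2618] -/
theorem gathering9_of_lemma84Rel {c' : ℝ} (hc' : 0 ≤ c') (h84 : Lemma84Rel c') :
    ∀ ε : ℝ, 0 < ε → ForAllLarge fun D _ χ => AssumptionA D χ →
      ∀ j ∈ ({1, 2, 3} : Finset ℕ),
        ‖Sj c' D j (a12 χ) (a22 χ) -
            (deriv χ.LFunction 1 ^ 2 *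
                (∑ n ∈ Finset.Ico 1 ⌈Skeleton.P3 D⌉₊, ∑ p ∈ Nat.divisorsAntidiagonal n,
                  ((ArithmeticFunction.moebius p.2).natAbs : ℂ) *
                        (‖χ ((p.1 * p.2 : ℕ) : ZMod D)‖ : ℂ) /
                      (((p.1 * p.2 : ℕ) : ℂ) * (Nat.totient p.2 : ℂ)) *
                    lamZero c' D j (p.1 * p.2) * PiW χ p.1 p.2 *
                    ((conj iota3 * frakfW c' D j 6 (Skeleton.P3 D / n) / (Real.log (Skeleton.P3 D) : ℂ) +
                        conj iota4 * frakfW c' D j 7 (Skeleton.P2 D / n) / (Real.log (Skeleton.P2 D) : ℂ)) *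
                      (iota3 * frakgW c' D j 6 (Skeleton.P3 D / n) / (Real.log (Skeleton.P3 D) : ℂ) +
                        iota4 * frakgW c' D j 7 (Skeleton.P2 D / n) / (Real.log (Skeleton.P2 D) : ℂ)))) +
              deriv χ.LFunction 1 ^ 2 *
                (∑ n ∈ Finset.Ico ⌈Skeleton.P3 D⌉₊ ⌈Skeleton.P2 D⌉₊, ∑ p ∈ Nat.divisorsAntidiagonal n,
                  ((ArithmeticFunction.moebius p.2).natAbs : ℂ) *
                        (‖χ ((p.1 * p.2 : ℕ) : ZMod D)‖ : ℂ) /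
                      (((p.1 * p.2 : ℕ) : ℂ) * (Nat.totient p.2 : ℂ)) *
                    lamZero c' D j (p.1 * p.2) * PiW χ p.1 p.2 *
                    (conj iota4 * frakfW c' D j 7 (Skeleton.P2 D / n) / (Real.log (Skeleton.P2 D) : ℂ) *
                      (iota4 * frakgW c' D j 7 (Skeleton.P2 D / n) / (Real.log (Skeleton.P2 D) : ℂ)))))‖
          ≤ ε * alpha D :=
  gathering9_of_rel hc'
    (u043R_of_lemma84W c' (W := fun n => (∏ q ∈ n.primeFactors, (1 - (q : ℝ)⁻¹)⁻¹) ^ 2)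
      (fun _ => sq_nonneg _) h84)
    (u9003R_of_lemma84W c' (W := fun n => (∏ q ∈ n.primeFactors, (1 - (q : ℝ)⁻¹)⁻¹) ^ 2)
      (fun _ => sq_nonneg _) h84)

/-! ## The leaf `Step9u004r c′` -/

/-- **`Z22:§9.u004` (reading (r)) from the RELATIVE Lemma 8.4**: for `c′ ≥ 0`,
`Skeleton.Lemma84Rel c′ → Section9Statements.Step9u004r c′` — gathering (G9) (this file) and partial
summation (PS9) (`Section9PartialSummation.ps9`, d17) via `step9u004r_of_gathering9`. The §9 twin of
`Section8FrontEnd44ReductionRel.step8u044_of_lemma84Rel`/`eq812_of_lemma84Rel`.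
[cite: Zhang2022LandauSiegel, §9 p.51, tex L2613–L2618] -/
theorem step9u004r_of_lemma84Rel {c' : ℝ} (hc' : 0 ≤ c') (h84 : Lemma84Rel c') :
    Section9Statements.Step9u004r c' :=
  Section9PartialSummation.step9u004r_of_gathering9 c' (gathering9_of_lemma84Rel hc' h84)

/-- **`Step9u004r c′` from the RELATIVE Lemma 8.3** (`c′ ≥ 0`), via
`Skeleton.lemma84Rel_of_lemma83Rel` (d27's contour engine `Section8Lemma84`).
[cite: Zhang2022LandauSiegel, §9 p.51; §8 Lemmas 8.3–8.4 pp.46–47] -/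
theorem step9u004r_of_lemma83Rel {c' : ℝ} (hc' : 0 ≤ c') (h83 : Lemma83Rel c') :
    Section9Statements.Step9u004r c' :=
  step9u004r_of_lemma84Rel hc' (lemma84Rel_of_lemma83Rel h83)

/-- **The leaf `h9u004r` of `Skeleton.theorem1_of_leaves_v19` is a consequence of the leaves `hAn`, `hRead`**
at the fixed `c′ ≥ 0`: `StepA_u007_analytic c′ → StepA_u007_read c′ → Step9u004r c′` (via
`Lemma83.lemma83Rel_of_parts`, d55's `AppendixALemma83Edge`). The skeleton pen may rethread
`have h9u004r : Step9u004r c' := Section9Gathering.step9u004r_of_appendixA hc' hAn hRead`.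
[cite: Zhang2022LandauSiegel, §9 p.51; App. A pp.101–103] -/
theorem step9u004r_of_appendixA {c' : ℝ} (hc' : 0 ≤ c')
    (hAn : Typed.AppendixA1.StepA_u007_analytic c') (hRead : Typed.AppendixA1.StepA_u007_read c') :
    Section9Statements.Step9u004r c' :=
  step9u004r_of_lemma83Rel hc' (Lemma83.lemma83Rel_of_parts c' hAn hRead)

end Literature.NumberTheory.LFunctions.Zhang2022.Section9Gathering

namespace Literature.NumberTheory.LFunctions.Zhang2022.Skeleton

/-- **`Lemma84Rel c′ → Section9Statements.Step9u004r c′`** (`c′ ≥ 0`) under the skeleton's name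
(re-export of `Section9Gathering.step9u004r_of_lemma84Rel`): the leaf `h9u004r` of the whole-DAG theorem
is discharged modulo the leaf family `Lemma84Rel ⇐ Lemma83Rel ⇐ {StepA_u007_analytic, StepA_u007_read}`.
[cite: Zhang2022LandauSiegel, §9 p.51] -/
theorem step9u004r_of_lemma84Rel {c' : ℝ} (hc' : 0 ≤ c') (h84 : Lemma84Rel c') :
    Section9Statements.Step9u004r c' :=
  Section9Gathering.step9u004r_of_lemma84Rel hc' h84

end Literature.NumberTheory.LFunctions.Zhang2022.Skeleton
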